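import Summits.QuantumFields.BalabanUV.Beta.CompositeVertexKernelRec

/-!
# `BalabanUV.Beta.CompositeVertexKernelBounds` — row D1 ∕ (C1), file F3 (brick-generic), part 2: BOUNDS, LOCALITY AND THE TWO
# INSTANTIATIONS of the top-peeled composite first-order kernels of `CompositeVertexKernelRec`

WHAT.  §1 BOUNDS by induction from uniform bounds `Bℓ`, `B𝓋` on the bricks: `|compLinKer m| ≤ ((d+1)(2L)^{d+1}Bℓ)^m`
(`abs_compLinKer_le`) and `|compVHKer m| ≤ bndVH m` (`abs_compVHKer_le`, `bndVH` the explicit recursive constant).  §2 LOCALITY: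
`locStencil_packVH_of_window` — node 7a's `locStencil_packVH` made window-generic (scale `N`, width `W`: constant `C·e^{2(d+1)Wδ}`),
and **`locStencil_compVhS`**: the packed composite family at blocking `L^m` is an an2 `LocStencil` family at EVERY rate `δ ≥ 0`
((LV)-shape letter).  §3 THE TWO INSTANTIATIONS BY NAME, letters discharged by an1's: (R) the ROOTED single-comb-order bricks
`ℓ m := linKerAt (toSite (r m)) L`, `𝓋 m := vhKerAt (toSite (r m)) L` (roots `r m ∈ box`): anchor **`compVhS_rooted_one`**
(`= vhSAt (toSite (r 0)) d L`), (LV) `locStencil_compVhS_rooted`, (TV) `compVhS_rooted_translate`; (S) the (0.4)-SYMMETRISED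
bricks `ℓ m := symLinKerAt (toSite r) L`, `𝓋 m := symVhKerAt (toSite r) L`: anchor **`compVhS_sym_one`** (`= symVhSAt (toSite r) d L`),
`locStencil_compVhS_sym`, `compVhS_sym_translate`.  So whichever presentation RULING R-D1-g49-2's (TAB_0) selects, the (C1)
composite first-order stencil family and its (LV)(TV) letters are in the tree.

[folklore] finite sums ∕ inductions over OUR typed objects + an1's brick letters BY NAME; one [our object] bookkeeping function
(`bndVH`).  Nothing of Bałaban's asserted, valued or discharged; 0 estimates; 0∕4 row-D1 binders; NOT (C1), NOT D1, NEVER «G-an2-4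
closed», NOT BetaPertH, NOT continuum, NOT Clay.

HONEST DEPENDENCY (page 1, mandatory): continuum YM on T⁴ ⇐ BetaPertH ∧ nine spine estimates (0/9 proved); BetaPertH ⇐ (D1) ∧
(D4) ∧ CAP+tail; G-an2-4 gates asym, D1 and NE2/3/4.  Row D1 ∕ (C1) OWNER an2, gen 50, 2026-08-23.  No existing file touched.
-/

noncomputable section

open scoped BigOperators

namespace Summit.QuantumFields.BalabanUV.Beta.CompositeVertexKernelRec

open Finset
open Literature.MathematicalPhysics.QuantumFieldTheory.Balaban1983to89
open Literature.MathematicalPhysics.QuantumFieldTheory.Balaban1983to89.Beta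
open AffineAveraging (Site box toSite)
open AveragingContours (blk off)
open AveragingHessianKernels (Bond Near packVH ell)
open AveragingHessianKernelsRooted (linKerAt vhKerAt vhSAt)
open SymAveragingHessianCounts (symLinKerAt symVhKerAt symVhSAt)
open ExpKernelCalculus (MKer BiLoc shiftK)
open OneStepResolventKernel (Fib LocStencil)
open B12Sec2to5 (l1 l1_nonneg)

variable {d : ℕ}
variable {ℓ : ℕ → Fin (d + 1) → Site (d + 1) → Bond (d + 1) → ℝ}
  {𝓋 : ℕ → Fin (d + 1) → Site (d + 1) → Bond (d + 1) → Bond (d + 1) → ℝ} {L : ℕ}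

/-! ## §1 Bounds by induction -/

/-- [folklore] The window has `(2L)^{d+1}` offsets. -/
theorem card_offs {L : ℕ} : ((offs L : Finset (Site (d + 1))).card : ℝ) = (2 * (L : ℝ)) ^ (d + 1) := by
  rw [offs, Fintype.card_piFinset, Finset.prod_const, Finset.card_univ, Fintype.card_fin]
  rw [Int.card_Icc]
  have : (2 * (L : ℤ) - 1 + 1 - 0).toNat = 2 * L := by omega
  rw [this]; push_cast; ring

/-- [folklore] BOUND ON THE COMPOSITE LINEAR KERNEL: `|compLinKer m| ≤ ((d+1)·(2L)^{d+1}·Bℓ)^m`. -/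
theorem abs_compLinKer_le {Bℓ : ℝ} (hB : 0 ≤ Bℓ) (hℓb : ∀ m μ y f, |ℓ m μ y f| ≤ Bℓ) :
    ∀ (m : ℕ) (f g : Bond (d + 1)),
      |compLinKer ℓ L m f g| ≤ (((d : ℝ) + 1) * (2 * (L : ℝ)) ^ (d + 1) * Bℓ) ^ m
  | 0, f, g => by
      rw [compLinKer_zero, pow_zero]
      split_ifs <;> simp
  | m + 1, f, g => by
      rw [compLinKer_succ]
      have IH := abs_compLinKer_le hB hℓb m f
      set C := ((d : ℝ) + 1) * (2 * (L : ℝ)) ^ (d + 1) * Bℓ with hC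
      have hCm : 0 ≤ C ^ m := pow_nonneg (by positivity) m
      calc |∑ κ : Fin (d + 1), ∑ e ∈ offs L, ℓ m g.1 g.2 (κ, (L : ℤ) • g.2 + e) * compLinKer ℓ L m f (κ, (L : ℤ) • g.2 + e)|
          ≤ ∑ κ : Fin (d + 1), ∑ e ∈ offs L, Bℓ * C ^ m := by
            refine (Finset.abs_sum_le_sum_abs _ _).trans (Finset.sum_le_sum fun κ _ => ?_)
            refine (Finset.abs_sum_le_sum_abs _ _).trans (Finset.sum_le_sum fun e _ => ?_)
            rw [abs_mul]
            exact mul_le_mul (hℓb _ _ _ _) (IH _) (abs_nonneg _) hB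
        _ = C ^ (m + 1) := by
            rw [Finset.sum_const, Finset.sum_const, Finset.card_univ, Fintype.card_fin, nsmul_eq_mul, nsmul_eq_mul,
              card_offs, pow_succ, hC]
            push_cast
            ring

/-- [our object — bookkeeping] The recursive bound of the composite vertex kernel: `bndVH 0 = 0`,
`bndVH (m+1) = ((d+1)(2L)^{d+1})²·B𝓋·Cℓ^{2m} + (d+1)(2L)^{d+1}·Bℓ·bndVH m`, `Cℓ = (d+1)(2L)^{d+1}Bℓ`. -/
def bndVH (d L : ℕ) (Bℓ B𝓋 : ℝ) : ℕ → ℝ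
  | 0 => 0
  | m + 1 =>
      (((d : ℝ) + 1) * (2 * (L : ℝ)) ^ (d + 1)) ^ 2 * B𝓋 * ((((d : ℝ) + 1) * (2 * (L : ℝ)) ^ (d + 1) * Bℓ) ^ m) ^ 2
        + ((d : ℝ) + 1) * (2 * (L : ℝ)) ^ (d + 1) * Bℓ * bndVH d L Bℓ B𝓋 m

/-- [folklore] `0 ≤ bndVH`. -/
theorem bndVH_nonneg {L : ℕ} {Bℓ B𝓋 : ℝ} (hB : 0 ≤ Bℓ) (hB' : 0 ≤ B𝓋) : ∀ m, 0 ≤ bndVH d L Bℓ B𝓋 m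
  | 0 => le_rfl
  | m + 1 => by
      have h : 0 ≤ bndVH d L Bℓ B𝓋 m := bndVH_nonneg hB hB' m
      show 0 ≤ (((d : ℝ) + 1) * (2 * (L : ℝ)) ^ (d + 1)) ^ 2 * B𝓋 * ((((d : ℝ) + 1) * (2 * (L : ℝ)) ^ (d + 1) * Bℓ) ^ m) ^ 2
        + ((d : ℝ) + 1) * (2 * (L : ℝ)) ^ (d + 1) * Bℓ * bndVH d L Bℓ B𝓋 m
      positivity

/-- [folklore] BOUND ON THE COMPOSITE VERTEX KERNEL: `|compVHKer m| ≤ bndVH m`. -/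
theorem abs_compVHKer_le {Bℓ B𝓋 : ℝ} (hB : 0 ≤ Bℓ) (hB' : 0 ≤ B𝓋) (hℓb : ∀ m μ y f, |ℓ m μ y f| ≤ Bℓ)
    (h𝓋b : ∀ m μ y f f', |𝓋 m μ y f f'| ≤ B𝓋) :
    ∀ (m : ℕ) (μ : Fin (d + 1)) (y : Site (d + 1)) (f f' : Bond (d + 1)),
      |compVHKer ℓ 𝓋 L m μ y f f'| ≤ bndVH d L Bℓ B𝓋 m
  | 0, _, _, _, _ => by rw [compVHKer_zero, abs_zero]; exact le_rfl
  | m + 1, μ, y, f, f' => by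
      rw [compVHKer_succ]
      set D := ((d : ℝ) + 1) * (2 * (L : ℝ)) ^ (d + 1) with hD
      set C := ((d : ℝ) + 1) * (2 * (L : ℝ)) ^ (d + 1) * Bℓ with hC
      have hCm : 0 ≤ C ^ m := pow_nonneg (by positivity) m
      have hIH := abs_compVHKer_le hB hB' hℓb h𝓋b m
      have hbm := bndVH_nonneg (d := d) (L := L) hB hB' m
      have hL1 := abs_compLinKer_le (ℓ := ℓ) (L := L) hB hℓb m
      have S1 : |∑ κ : Fin (d + 1), ∑ e ∈ offs L, ∑ κ' : Fin (d + 1), ∑ e' ∈ offs L,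
          𝓋 m μ y (κ, (L : ℤ) • y + e) (κ', (L : ℤ) • y + e')
            * compLinKer ℓ L m f (κ, (L : ℤ) • y + e) * compLinKer ℓ L m f' (κ', (L : ℤ) • y + e')|
          ≤ D ^ 2 * B𝓋 * (C ^ m) ^ 2 := by
        calc _ ≤ ∑ κ : Fin (d + 1), ∑ e ∈ offs L, ∑ κ' : Fin (d + 1), ∑ e' ∈ offs L, B𝓋 * C ^ m * C ^ m := by
              refine (Finset.abs_sum_le_sum_abs _ _).trans (Finset.sum_le_sum fun κ _ => ?_)
              refine (Finset.abs_sum_le_sum_abs _ _).trans (Finset.sum_le_sum fun e _ => ?_)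
              refine (Finset.abs_sum_le_sum_abs _ _).trans (Finset.sum_le_sum fun κ' _ => ?_)
              refine (Finset.abs_sum_le_sum_abs _ _).trans (Finset.sum_le_sum fun e' _ => ?_)
              rw [abs_mul, abs_mul]
              exact mul_le_mul (mul_le_mul (h𝓋b _ _ _ _ _) (hL1 _ _) (abs_nonneg _) hB') (hL1 _ _) (abs_nonneg _)
                (mul_nonneg hB' hCm)
          _ = D ^ 2 * B𝓋 * (C ^ m) ^ 2 := by
              simp only [Finset.sum_const, Finset.card_univ, Fintype.card_fin, nsmul_eq_mul, card_offs]
              rw [hD]; push_cast; ring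
      have S2 : |∑ κ : Fin (d + 1), ∑ e ∈ offs L, ℓ m μ y (κ, (L : ℤ) • y + e) * compVHKer ℓ 𝓋 L m κ ((L : ℤ) • y + e) f f'|
          ≤ D * Bℓ * bndVH d L Bℓ B𝓋 m := by
        calc _ ≤ ∑ κ : Fin (d + 1), ∑ e ∈ offs L, Bℓ * bndVH d L Bℓ B𝓋 m := by
              refine (Finset.abs_sum_le_sum_abs _ _).trans (Finset.sum_le_sum fun κ _ => ?_)
              refine (Finset.abs_sum_le_sum_abs _ _).trans (Finset.sum_le_sum fun e _ => ?_)
              rw [abs_mul]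
              exact mul_le_mul (hℓb _ _ _ _) (hIH _ _ _ _) (abs_nonneg _) hB
          _ = D * Bℓ * bndVH d L Bℓ B𝓋 m := by
              simp only [Finset.sum_const, Finset.card_univ, Fintype.card_fin, nsmul_eq_mul, card_offs]
              rw [hD]; push_cast; ring
      calc _ ≤ _ := abs_add_le _ _
        _ ≤ D ^ 2 * B𝓋 * (C ^ m) ^ 2 + D * Bℓ * bndVH d L Bℓ B𝓋 m := add_le_add S1 S2
        _ = bndVH d L Bℓ B𝓋 (m + 1) := by rw [hD, hC]; rfl

/-! ## §2 The packed family is a local stencil family — node 7a's `locStencil_packVH`, window-generic -/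

/-- [folklore] The coarse image `N·y` lies in its own window. -/
theorem smul_mem_winF {N W : ℕ} (y : Site (d + 1)) : (N : ℤ) • y ∈ winF N W y := by
  rw [mem_winF_iff]; intro i
  simp only [Pi.smul_apply, smul_eq_mul]
  constructor
  · exact le_rfl
  · have : (0 : ℤ) ≤ (W : ℤ) := Int.natCast_nonneg W
    linarith

/-- [folklore] Two points of one window are `ℓ¹`-close: `|x − u|₁ ≤ (d+1)·W`. -/
theorem l1_le_of_mem_winF {N W : ℕ} {y x u : Site (d + 1)} (hx : x ∈ winF N W y) (hu : u ∈ winF N W y) :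
    l1 (x - u) ≤ ((d : ℝ) + 1) * W := by
  rw [mem_winF_iff] at hx hu
  unfold B12Sec2to5.l1
  have h : ∀ i ∈ (Finset.univ : Finset (Fin (d + 1))), |(((x - u) i : ℤ) : ℝ)| ≤ (W : ℝ) := by
    intro i _
    obtain ⟨h1, h2⟩ := hx i
    obtain ⟨h3, h4⟩ := hu i
    rw [Pi.sub_apply, ← Int.cast_abs]
    have : |x i - u i| ≤ (W : ℤ) := by rw [abs_le]; constructor <;> linarith
    exact_mod_cast this
  refine (Finset.sum_le_card_nsmul _ _ _ h).trans ?_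
  rw [Finset.card_univ, Fintype.card_fin, nsmul_eq_mul]
  push_cast
  nlinarith

/-- [folklore] **A PACKED KERNEL FAMILY SUPPORTED IN SCALE-`N` WINDOWS OF WIDTH `W` IS A LOCAL STENCIL FAMILY** at every rate `δ ≥ 0`,
constant `C · e^{2(d+1)Wδ}` (node 7a's `locStencil_packVH` is, up to one unit of width, the case `N = L`, `W = 2L`). -/
theorem locStencil_packVH_of_window (K : Fin (d + 1) → Site (d + 1) → Bond (d + 1) → Bond (d + 1) → ℝ)
    {N : ℕ} (hN : 1 ≤ N) (W : ℕ) {C : ℝ} (hC : 0 ≤ C)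
    (h₁ : ∀ μ y f f', f.2 ∉ winF N W y → K μ y f f' = 0) (h₂ : ∀ μ y f f', f'.2 ∉ winF N W y → K μ y f f' = 0)
    (hb : ∀ μ y f f', |K μ y f f'| ≤ C) {δ : ℝ} (hδ : 0 ≤ δ) :
    LocStencil (packVH K N) (C * Real.exp (2 * ((d : ℝ) + 1) * W * δ)) δ := by
  intro κ' u x z a b
  have hpos : 0 ≤ C * Real.exp (2 * ((d : ℝ) + 1) * W * δ) * Real.exp (-δ * (l1 (x - u) + l1 (z - u))) :=
    mul_nonneg (mul_nonneg hC (Real.exp_pos _).le) (Real.exp_pos _).le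
  have key : ∀ (x z : Site (d + 1)) (μ α : Fin (d + 1)), AveragingContours.off N z = 0 →
      |K μ (AveragingContours.blk N z) (α, x) (κ', u)| ≤
        C * Real.exp (2 * ((d : ℝ) + 1) * W * δ) * Real.exp (-δ * (l1 (x - u) + l1 (z - u))) := by
    intro x z μ α hz
    have hpos' : 0 ≤ C * Real.exp (2 * ((d : ℝ) + 1) * W * δ) * Real.exp (-δ * (l1 (x - u) + l1 (z - u))) :=
      mul_nonneg (mul_nonneg hC (Real.exp_pos _).le) (Real.exp_pos _).le
    by_cases hx : x ∈ winF N W (AveragingContours.blk N z)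
    · by_cases hu : u ∈ winF N W (AveragingContours.blk N z)
      · have hz' : z ∈ winF N W (AveragingContours.blk N z) := by
          have h0 := smul_mem_winF (N := N) (W := W) (AveragingContours.blk N z)
          rwa [← AveragingHessianKernels.eq_smul_blk_of_off_eq_zero hN hz] at h0
        have d1 := l1_le_of_mem_winF hx hu
        have d2 := l1_le_of_mem_winF hz' hu
        have hW' : (0 : ℝ) ≤ (W : ℝ) := Nat.cast_nonneg W
        have hsum : δ * (l1 (x - u) + l1 (z - u)) ≤ 2 * ((d : ℝ) + 1) * W * δ := by nlinarith
        have h1 : 1 ≤ Real.exp (2 * ((d : ℝ) + 1) * W * δ) * Real.exp (-δ * (l1 (x - u) + l1 (z - u))) := by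
          rw [← Real.exp_add]; exact Real.one_le_exp (by linarith)
        calc |K μ (AveragingContours.blk N z) (α, x) (κ', u)| ≤ C * 1 := by rw [mul_one]; exact hb _ _ _ _
          _ ≤ C * (Real.exp (2 * ((d : ℝ) + 1) * W * δ) * Real.exp (-δ * (l1 (x - u) + l1 (z - u)))) :=
              mul_le_mul_of_nonneg_left h1 hC
          _ = _ := by ring
      · rw [h₂ _ _ _ _ hu, abs_zero]; exact hpos'
    · rw [h₁ _ _ _ _ hx, abs_zero]; exact hpos'
  rcases a with α | μ <;> rcases b with α' | μ'
  · rw [AveragingHessianKernels.packVH_inl_inl, abs_zero]; exact hpos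
  · rw [AveragingHessianKernels.packVH_inl_inr]
    split_ifs with hz
    · exact key x z μ' α hz
    · rw [abs_zero]; exact hpos
  · rw [AveragingHessianKernels.packVH_inr_inl]
    split_ifs with hx
    · rw [add_comm (l1 (x - u))]; exact key z x μ α' hx
    · rw [abs_zero]; exact hpos
  · rw [AveragingHessianKernels.packVH_inr_inr, abs_zero]; exact hpos

/-- [folklore] **(LV)-SHAPE LOCALITY OF THE PACKED COMPOSITE FAMILY AT EVERY RATE**: `LocStencil (compVhS … m) (bndVH m · e^{2(d+1)·wid m·δ}) δ`. -/
theorem locStencil_compVhS {L : ℕ} (hL : 1 ≤ L) {Bℓ B𝓋 : ℝ} (hB : 0 ≤ Bℓ) (hB' : 0 ≤ B𝓋)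
    (hℓb : ∀ m μ y f, |ℓ m μ y f| ≤ Bℓ) (h𝓋b : ∀ m μ y f f', |𝓋 m μ y f f'| ≤ B𝓋) (m : ℕ) {δ : ℝ} (hδ : 0 ≤ δ) :
    LocStencil (compVhS ℓ 𝓋 L m) (bndVH d L Bℓ B𝓋 m * Real.exp (2 * ((d : ℝ) + 1) * (wid L m) * δ)) δ := by
  have hLm : 1 ≤ L ^ m := Nat.one_le_pow m L hL
  unfold compVhS
  refine locStencil_packVH_of_window _ hLm (wid L m) (bndVH_nonneg hB hB' m) (fun μ y f f' h => ?_)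
    (fun μ y f f' h => ?_) (abs_compVHKer_le hB hB' hℓb h𝓋b m) hδ
  · exact compVHKer_eq_zero_left m f' h
  · exact compVHKer_eq_zero_right m f h

/-! ## §3 The two instantiations by name -/

section Rooted

variable {r : ℕ → (Fin (d + 1) → ℕ)}

/-- [folklore] (R) ANCHOR: over an1's ROOTED single-comb-order bricks the depth-one composite vertex kernel IS `vhKerAt (toSite (r 0)) L`. -/
theorem compVHKer_rooted_one (hr : ∀ k, r k ∈ box (d + 1) L) (μ : Fin (d + 1)) (y : Site (d + 1)) (f f' : Bond (d + 1)) :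
    compVHKer (fun m => linKerAt (toSite (r m)) L) (fun m => vhKerAt (toSite (r m)) L) L 1 μ y f f'
      = vhKerAt (toSite (r 0)) L μ y f f' :=
  compVHKer_one (fun m _ _ _ f' h => AveragingHessianKernelsRooted.vhKerAt_eq_zero_left (hr m) h f')
    (fun m _ _ f _ h => AveragingHessianKernelsRooted.vhKerAt_eq_zero_right (hr m) f h) μ y f f'

/-- [folklore] (R) ANCHOR AT THE STENCIL LEVEL: the depth-one packed composite family IS an1's rooted `vhSAt (toSite (r 0)) d L`. -/
theorem compVhS_rooted_one (hr : ∀ k, r k ∈ box (d + 1) L) :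
    compVhS (fun m => linKerAt (toSite (r m)) L) (fun m => vhKerAt (toSite (r m)) L) L 1 = vhSAt (toSite (r 0)) d L rfl := by
  have e : compVHKer (fun m => linKerAt (toSite (r m)) L) (fun m => vhKerAt (toSite (r m)) L) L 1 = vhKerAt (toSite (r 0)) L := by
    funext μ y f f'
    exact compVHKer_rooted_one hr μ y f f'
  unfold compVhS AveragingHessianKernelsRooted.vhSAt
  rw [e, pow_one]

/-- [folklore] (R) (LV): the rooted composite family at blocking `L^m` is a local stencil family at every rate. -/
theorem locStencil_compVhS_rooted (hL : 1 ≤ L) (hr : ∀ k, r k ∈ box (d + 1) L) (m : ℕ) {δ : ℝ} (hδ : 0 ≤ δ) :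
    LocStencil (compVhS (fun m => linKerAt (toSite (r m)) L) (fun m => vhKerAt (toSite (r m)) L) L m)
      (bndVH d L (ell (d + 1) L : ℝ) (3 * (ell (d + 1) L : ℝ) ^ 2) m * Real.exp (2 * ((d : ℝ) + 1) * (wid L m) * δ)) δ :=
  locStencil_compVhS hL (by positivity) (by positivity)
    (fun m μ y f => AveragingHessianKernelsRooted.abs_linKerAt_le hL μ y (hr m) f)
    (fun m μ y f f' => AveragingHessianKernelsRooted.abs_vhKerAt_le hL μ y (hr m) f f') m hδ

/-- [folklore] (R) (TV): block-translation covariance of the rooted composite family at blocking `L^m`. -/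
theorem compVhS_rooted_translate (hL : 1 ≤ L) (m : ℕ) (κ' : Fin (d + 1)) (u t : Site (d + 1)) :
    compVhS (fun m => linKerAt (toSite (r m)) L) (fun m => vhKerAt (toSite (r m)) L) L m κ' (u + ((L ^ m : ℕ) : ℤ) • t)
      = shiftK (-(((L ^ m : ℕ) : ℤ) • t))
          (compVhS (fun m => linKerAt (toSite (r m)) L) (fun m => vhKerAt (toSite (r m)) L) L m κ' u) :=
  compVhS_translate hL (fun _ μ y t f => AveragingHessianKernelsRooted.linKerAt_add _ L μ y t f)
    (fun _ μ y t f f' => AveragingHessianKernelsRooted.vhKerAt_add _ L μ y t f f') m κ' u t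

end Rooted

section Sym

variable {r : Fin (d + 1) → ℕ}

/-- [folklore] (S) ANCHOR: over an1's (0.4)-SYMMETRISED bricks the depth-one composite vertex kernel IS `symVhKerAt (toSite r) L`. -/
theorem compVHKer_sym_one (hr : r ∈ box (d + 1) L) (μ : Fin (d + 1)) (y : Site (d + 1)) (f f' : Bond (d + 1)) :
    compVHKer (fun _ => symLinKerAt (toSite r) L) (fun _ => symVhKerAt (toSite r) L) L 1 μ y f f'
      = symVhKerAt (toSite r) L μ y f f' :=
  compVHKer_one (fun _ _ _ _ f' h => SymAveragingHessianCounts.symVhKerAt_eq_zero_left hr h f')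
    (fun _ _ _ f _ h => SymAveragingHessianCounts.symVhKerAt_eq_zero_right hr f h) μ y f f'

/-- [folklore] (S) ANCHOR AT THE STENCIL LEVEL: the depth-one packed composite family IS an1's `symVhSAt (toSite r) d L`. -/
theorem compVhS_sym_one (hr : r ∈ box (d + 1) L) :
    compVhS (fun _ => symLinKerAt (toSite r) L) (fun _ => symVhKerAt (toSite r) L) L 1 = symVhSAt (toSite r) d L rfl := by
  have e : compVHKer (fun _ => symLinKerAt (toSite r) L) (fun _ => symVhKerAt (toSite r) L) L 1 = symVhKerAt (toSite r) L := by
    funext μ y f f'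
    exact compVHKer_sym_one hr μ y f f'
  unfold compVhS SymAveragingHessianCounts.symVhSAt
  rw [e, pow_one]

/-- [folklore] (S) (LV): the symmetrised composite family at blocking `L^m` is a local stencil family at every rate. -/
theorem locStencil_compVhS_sym (hL : 1 ≤ L) (hr : r ∈ box (d + 1) L) (m : ℕ) {δ : ℝ} (hδ : 0 ≤ δ) :
    LocStencil (compVhS (fun _ => symLinKerAt (toSite r) L) (fun _ => symVhKerAt (toSite r) L) L m)
      (bndVH d L (ell (d + 1) L : ℝ) (3 * (ell (d + 1) L : ℝ) ^ 2) m * Real.exp (2 * ((d : ℝ) + 1) * (wid L m) * δ)) δ :=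
  locStencil_compVhS hL (by positivity) (by positivity)
    (fun _ μ y f => SymAveragingHessianCounts.abs_symLinKerAt_le hL μ y hr f)
    (fun _ μ y f f' => SymAveragingHessianCounts.abs_symVhKerAt_le hL μ y hr f f') m hδ

/-- [folklore] (S) (TV): block-translation covariance of the symmetrised composite family at blocking `L^m`. -/
theorem compVhS_sym_translate (hL : 1 ≤ L) (m : ℕ) (κ' : Fin (d + 1)) (u t : Site (d + 1)) :
    compVhS (fun _ => symLinKerAt (toSite r) L) (fun _ => symVhKerAt (toSite r) L) L m κ' (u + ((L ^ m : ℕ) : ℤ) • t)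
      = shiftK (-(((L ^ m : ℕ) : ℤ) • t))
          (compVhS (fun _ => symLinKerAt (toSite r) L) (fun _ => symVhKerAt (toSite r) L) L m κ' u) :=
  compVhS_translate hL (fun _ μ y t f => SymAveragingHessianCounts.symLinKerAt_add _ L μ y t f)
    (fun _ μ y t f f' => SymAveragingHessianCounts.symVhKerAt_add _ L μ y t f f') m κ' u t

end Sym

end Summit.QuantumFields.BalabanUV.Beta.CompositeVertexKernelRec

end
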